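import Summits.CriticalPhenomena.PercolationContinuityZ3.Theorems.PercNearOneGluingNoHeavyLowerTailSunflowerMatroidPartition
import HarnessLib
import HarnessLib.Audit

/-!
# `NoHeavyLowerTail` (crux stmt-CriticalPhenomena-4575), abstract sunflower cubic: the RIVAL-FREE RAINBOWS are paid by the bottom slack —
# a per-rainbow form of gen 20's intersecting-petal theorem, `#{ρ : Q1_ρ rival-free} ≤ Σ_{lab S = 0} cubeSlack Sᶜ`

Support file (seat `prim-l12-p2` gen 21; `--supports stmt-CriticalPhenomena-4575`).  No `sorry`, no definitions.
Memo: run/shared/lean/prim/prim-l12/prim-l12-p2/FINDING-g21-LEMMA-B-IDENTITY-AND-MATROID-PARTITION.md §3(c).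

A rainbow `ρ = (Q1,Q2,Q3)` is RIVAL-FREE (at petal 1) if every label-1 set meets `Q1` (no `D ∈ C1` with `D ∩ Q1 = ∅`).  Gen 20 proved
`RainbowKernelIndependence`/(★_B) when petal 1 is an intersecting family, i.e. when EVERY rainbow is rival-free; its left inverse
`kB_rbVec` uses that hypothesis only through the local proviso of the complement reading lemma for the one set `Q1'`.  Hence:
* `Sunflower.kB_rbVec_of_rivalFree` : for a rival-free `ρ'` and ANY rainbow `ρ`, `⟨k_ρ', rbVec ρ⟩ = [ρ = ρ']`;
* `Sunflower.tsB_linearIndependent_rivalFree` : the TS-B parts of the rival-free rainbows are linearly independent over `GF(2)`;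
* **`Sunflower.card_rivalFree_le_bottomSlack`** : `#{rival-free rainbows} ≤ Σ_{lab S = 0} cubeSlack Sᶜ` (one-sided rank bound
  `card_le_slack_of_linearIndependent` of `…SunflowerMatroidPartition`).  So in the matroid-partition programme the rival-free rainbows can
  always be put in `R_B`; census (gen 21): the complementary assignment `R_A = {Q1 has a rival}` is A-independent in 96 % of instances only —
  the remaining work is on rainbows with rivals (the three-hub family has all rainbows with rivals and `KA = 0`).
-/

namespace Summit.CriticalPhenomena.PercolationContinuityZ3.Theorems.SunflowerPartition

open Finset

namespace Sunflower

variable {α : Type*} [Fintype α] [DecidableEq α] (F : Sunflower α)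

/-! ## The left inverse for one rival-free rainbow -/

/-- **EXACT LEFT INVERSE, PER RAINBOW** (this work; gen 20's `kB_rbVec` with the intersecting hypothesis localised).  If the first block
`Q1'` of the rainbow `ρ'` is RIVAL-FREE (every label-1 set meets `Q1'`), then for ALL rainbows `ρ` the functional
`k_ρ' = Σ_{S ⊆ Q3', lab S = 0, lab (Q1'ᶜ∖S) = 4} N_{Q1'ᶜ}(S,Q3') · (e_S ⊗ M-row of Sᶜ ∖ Q1')` satisfies `⟨k_ρ', rbVec ρ⟩ = [ρ = ρ']`:
by `rbVec_read_compl` each term reads `N(S,Q3')·M(Q3_ρ,S)·[Q1 = Q1']`, and `Σ_S M(Q3_ρ,S)N(S,Q3') = [Q3_ρ = Q3']` is the cube theorem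
`crossKey` in the cube `Q1ᶜ`. [this work] -/
theorem kB_rbVec_of_rivalFree
    {ρ ρ' : Finset α × Finset α} (hρ : ρ ∈ F.dem) (hr : F.IsRainbow ρ) (hρ' : ρ' ∈ F.dem) (hr' : F.IsRainbow ρ')
    (hrf : ∀ D : Finset α, F.lab D = 1 → (D ∩ ρ'.1).Nonempty) :
    (∑ σ ∈ F.sup,
        (∑ S ∈ ((ρ'.1 ∪ ρ'.2)ᶜ).powerset.filter (fun S => F.lab S = 0 ∧ F.lab (ρ'.1ᶜ \ S) = 4),
            F.certN ρ' S *
              (if σ.2 = S then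
                ∑ R' ∈ (Sᶜ).powerset, (if F.lab R' = 0 ∧ (σ.1 ∪ σ.2)ᶜ ⊆ R' ∧ R' ⊆ Sᶜ \ ρ'.1 then (1 : ZMod 2) else 0)
               else 0)) * F.rbVec ρ σ)
      = if ρ = ρ' then 1 else 0 := by
  obtain ⟨hdisj, hQ1, hQ2, hQ3⟩ := F.dem_rainbow_facts hρ hr
  obtain ⟨hdisj', hQ1', hQ2', hQ3'⟩ := F.dem_rainbow_facts hρ' hr'
  set filtS := ((ρ'.1 ∪ ρ'.2)ᶜ).powerset.filter (fun S => F.lab S = 0 ∧ F.lab (ρ'.1ᶜ \ S) = 4) with hfS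
  -- the row functional of `S`
  let row : Finset α → Finset α × Finset α → ZMod 2 := fun S σ =>
    if σ.2 = S then ∑ R' ∈ (Sᶜ).powerset, (if F.lab R' = 0 ∧ (σ.1 ∪ σ.2)ᶜ ⊆ R' ∧ R' ⊆ Sᶜ \ ρ'.1 then (1 : ZMod 2) else 0)
    else 0
  -- the TS-B coefficient of `ρ` at `S`
  let mS : Finset α → ZMod 2 := fun S =>
    ∑ R' ∈ (Finset.univ : Finset α).powerset, (if F.lab R' = 0 ∧ S ⊆ R' ∧ R' ⊆ (ρ.1 ∪ ρ.2)ᶜ then (1 : ZMod 2) else 0)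
  -- STEP 1: exchange the sums
  have step1 : (∑ σ ∈ F.sup, (∑ S ∈ filtS, F.certN ρ' S * row S σ) * F.rbVec ρ σ)
      = ∑ S ∈ filtS, F.certN ρ' S * (∑ σ ∈ F.sup, (if σ.2 = S then
          (∑ R' ∈ (Sᶜ).powerset, (if F.lab R' = 0 ∧ (σ.1 ∪ σ.2)ᶜ ⊆ R' ∧ R' ⊆ Sᶜ \ ρ'.1 then (1 : ZMod 2) else 0)) * F.rbVec ρ σ
          else 0)) := by
    rw [show (∑ σ ∈ F.sup, (∑ S ∈ filtS, F.certN ρ' S * row S σ) * F.rbVec ρ σ)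
        = ∑ σ ∈ F.sup, ∑ S ∈ filtS, F.certN ρ' S * (row S σ * F.rbVec ρ σ) from
      sum_congr rfl fun σ _ => by rw [Finset.sum_mul]; exact sum_congr rfl fun S _ => by ring]
    rw [Finset.sum_comm]
    refine sum_congr rfl fun S _ => ?_
    rw [Finset.mul_sum]
    refine sum_congr rfl fun σ _ => ?_
    simp only [row]
    by_cases h : σ.2 = S
    · rw [if_pos h, if_pos h]
    · rw [if_neg h, if_neg h, zero_mul]
  rw [step1]
  -- STEP 2: read each `S`
  have step2 : ∀ S ∈ filtS, (∑ σ ∈ F.sup, (if σ.2 = S then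
          (∑ R' ∈ (Sᶜ).powerset, (if F.lab R' = 0 ∧ (σ.1 ∪ σ.2)ᶜ ⊆ R' ∧ R' ⊆ Sᶜ \ ρ'.1 then (1 : ZMod 2) else 0)) * F.rbVec ρ σ
          else 0))
        = if F.lab S = 0 ∧ S ⊆ (ρ.1 ∪ ρ.2)ᶜ ∧ F.lab (Sᶜ \ ρ.1) = 4 then mS S * (if ρ'.1 = ρ.1 then 1 else 0) else 0 := by
    intro S hS
    obtain ⟨hSQ3, hS0, hS4⟩ := mem_filter.1 hS
    rw [mem_powerset] at hSQ3
    have hP'S : ρ'.1 ⊆ Sᶜ := by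
      intro x hx; rw [mem_compl]; intro hxS
      have := hSQ3 hxS; rw [mem_compl, mem_union, not_or] at this; exact this.1 hx
    have hriv : ∀ D, D ⊆ Sᶜ \ ρ'.1 → F.lab D ≠ 1 := by
      intro D hD hD1
      obtain ⟨x, hx⟩ := hrf D hD1
      exact (mem_sdiff.1 (hD (mem_inter.1 hx).1)).2 (mem_inter.1 hx).2
    exact F.rbVec_read_compl hρ hr hS0 hP'S hQ1' hriv
  rw [sum_congr rfl fun S hS => by rw [step2 S hS]]
  -- STEP 3: the case `Q1 ≠ Q1'`
  by_cases heq : ρ'.1 = ρ.1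
  swap
  · rw [show (∑ S ∈ filtS, F.certN ρ' S *
          (if F.lab S = 0 ∧ S ⊆ (ρ.1 ∪ ρ.2)ᶜ ∧ F.lab (Sᶜ \ ρ.1) = 4 then mS S * (if ρ'.1 = ρ.1 then 1 else 0) else 0)) = 0 from
      sum_eq_zero fun S _ => by rw [if_neg heq, mul_zero, ite_self, mul_zero]]
    rw [if_neg]
    rintro rfl
    exact heq rfl
  -- STEP 4: `Q1 = Q1'`: the cube theorem in `Q1ᶜ`
  simp only [heq, if_true, mul_one]
  set W := ρ.1ᶜ with hW
  set Y := (ρ.1 ∪ ρ.2)ᶜ with hY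
  set Y'' := (ρ'.1 ∪ ρ'.2)ᶜ with hY''
  have hYW : Y ⊆ W := by
    intro x hx; rw [hY, mem_compl, mem_union, not_or] at hx; exact mem_compl.2 hx.1
  have hY''W : Y'' ⊆ W := by
    intro x hx; rw [hY'', mem_compl, mem_union, not_or] at hx; rw [hW, ← heq]; exact mem_compl.2 hx.1
  have hWY : W \ Y = ρ.2 := (snd_eq_compl_sdiff hdisj).symm
  have hWY'' : W \ Y'' = ρ'.2 := by rw [hW, ← heq]; exact (snd_eq_compl_sdiff hdisj').symm
  have key := F.crossKey W (Y := Y) (Y'' := Y'') hYW hY''W (by rw [hQ3]; decide) (by rw [hWY, hQ2]; decide)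
    (by rw [hQ3']; decide) (by rw [hWY'', hQ2']; decide) (by rw [hWY'', hQ2']; decide) (by rw [hWY'', hQ2', hQ3]; decide)
  -- `[Y = Y''] = [ρ = ρ']`
  have hiff : (if Y = Y'' then (1 : ZMod 2) else 0) = if ρ = ρ' then 1 else 0 := by
    by_cases h : ρ = ρ'
    · rw [if_pos h, if_pos (by rw [hY, hY'', h])]
    · rw [if_neg h, if_neg]
      intro hYY
      apply h
      have h2 : ρ.2 = ρ'.2 := by rw [← hWY, ← hWY'', hYY]
      exact Prod.ext heq.symm h2
  rw [← hiff, ← key]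
  -- compare the two `S`-sums termwise, after extending ours to `W.powerset`
  have hfW : filtS ⊆ W.powerset := fun S hS => mem_powerset.2 ((mem_powerset.1 (mem_filter.1 hS).1).trans hY''W)
  -- our summand, as a function on all `S`
  let g : Finset α → ZMod 2 := fun S =>
    F.certN ρ' S * (if F.lab S = 0 ∧ S ⊆ Y ∧ F.lab (Sᶜ \ ρ.1) = 4 then mS S else 0)
  have hScQ1 : ∀ S : Finset α, Sᶜ \ ρ.1 = ρ'.1ᶜ \ S := by
    intro S; rw [heq]; ext x; simp only [mem_sdiff, mem_compl]; tauto
  -- `certN ρ' S` is the `N`-factor of `crossKey`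
  have hN : ∀ S : Finset α, F.certN ρ' S
      = ∑ R ∈ W.powerset, (if F.lab R = 4 ∧ W \ Y'' ⊆ R ∧ R ⊆ W \ S then (1 : ZMod 2) else 0) := by
    intro S; unfold certN; rw [hW, ← heq]
  have hvanish : ∀ S ∈ W.powerset, S ∉ filtS → g S = 0 := by
    intro S hSW hSf
    have hSW' : S ⊆ W := mem_powerset.1 hSW
    show F.certN ρ' S * (if F.lab S = 0 ∧ S ⊆ Y ∧ F.lab (Sᶜ \ ρ.1) = 4 then mS S else 0) = 0
    by_cases hc : F.lab S = 0 ∧ S ⊆ Y ∧ F.lab (Sᶜ \ ρ.1) = 4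
    · -- then `S ∉ filtS` forces `S ⊄ Y''`, and `certN ρ' S = 0`
      have hS4 : F.lab (ρ'.1ᶜ \ S) = 4 := by rw [← hScQ1]; exact hc.2.2
      have hSY'' : ¬ S ⊆ Y'' := fun h => hSf (mem_filter.2 ⟨mem_powerset.2 h, hc.1, hS4⟩)
      rw [hN S, show (∑ R ∈ W.powerset, (if F.lab R = 4 ∧ W \ Y'' ⊆ R ∧ R ⊆ W \ S then (1 : ZMod 2) else 0)) = 0 from ?_,
        zero_mul]
      refine sum_eq_zero fun R _ => if_neg fun h => hSY'' fun x hxS => ?_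
      by_contra hxY
      have hxW : x ∈ W := hSW' hxS
      have : x ∈ W \ Y'' := mem_sdiff.2 ⟨hxW, hxY⟩
      exact (mem_sdiff.1 (h.2.2 (h.2.1 this))).2 hxS
    · rw [if_neg hc, mul_zero]
  rw [show (∑ S ∈ filtS, F.certN ρ' S * (if F.lab S = 0 ∧ S ⊆ Y ∧ F.lab (Sᶜ \ ρ.1) = 4 then mS S else 0))
      = ∑ S ∈ W.powerset, g S from (Finset.sum_subset hfW hvanish)]
  refine sum_congr rfl fun S hSW => ?_
  have hSW' : S ⊆ W := mem_powerset.1 hSW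
  show F.certN ρ' S * (if F.lab S = 0 ∧ S ⊆ Y ∧ F.lab (Sᶜ \ ρ.1) = 4 then mS S else 0)
    = (∑ R' ∈ W.powerset, (if F.lab R' = 0 ∧ S ⊆ R' ∧ R' ⊆ Y then (1 : ZMod 2) else 0)) *
      (∑ R ∈ W.powerset, (if F.lab R = 4 ∧ W \ Y'' ⊆ R ∧ R ⊆ W \ S then (1 : ZMod 2) else 0))
  rw [← hN S]
  by_cases hc : F.lab S = 0 ∧ S ⊆ Y ∧ F.lab (Sᶜ \ ρ.1) = 4
  · rw [if_pos hc, mul_comm]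
    congr 1
    show (∑ R' ∈ (Finset.univ : Finset α).powerset, (if F.lab R' = 0 ∧ S ⊆ R' ∧ R' ⊆ Y then (1 : ZMod 2) else 0)) = _
    rw [F.sum_pow_to 0 S Y Finset.univ (subset_univ _), F.sum_pow_to 0 S Y W hYW]
  · rw [if_neg hc, mul_zero]
    symm
    by_cases hS0 : F.lab S = 0
    · by_cases hSY : S ⊆ Y
      · have h4 : F.lab (ρ'.1ᶜ \ S) ≠ 4 := fun h => hc ⟨hS0, hSY, by rw [hScQ1]; exact h⟩
        rw [hN S, F.crossN_eq_zero_of_lab_ne W (Y'' := Y'') (by rw [hW, ← heq]; exact h4), mul_zero]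
      · rw [show (∑ R' ∈ W.powerset, (if F.lab R' = 0 ∧ S ⊆ R' ∧ R' ⊆ Y then (1 : ZMod 2) else 0)) = 0 from
          sum_eq_zero fun R' _ => if_neg fun h => hSY (h.2.1.trans h.2.2), zero_mul]
    · rw [F.crossM_eq_zero_of_lab_ne W (Y := Y) hS0, zero_mul]

/-! ## Independence of the rival-free family -/

/-- **Independence of the rival-free rainbows' TS-B vectors** (this work): the restrictions to the bottom-spectator supplies of the `rbVec ρ`,
`ρ` ranging over any set `R` of rainbows whose first blocks are rival-free, are linearly independent — each has the explicit left inverse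
`kB_rbVec_of_rivalFree`, supported on `sup_B`. [this work] -/
theorem tsB_linearIndependent_rivalFree (R : Finset (Finset α × Finset α))
    (hR : R ⊆ F.dem.filter (fun d => F.IsRainbow d)) (hRF : ∀ ρ ∈ R, ∀ D : Finset α, F.lab D = 1 → (D ∩ ρ.1).Nonempty) :
    LinearIndependent (ZMod 2)
      (fun ρ : ↥R => fun σ : ↥(F.sup.filter (fun σ => F.lab σ.2 = 0)) => F.rbVec ρ.1 σ.1) := by
  rw [Fintype.linearIndependent_iff]
  intro g hg ρ'
  have hρ'R : ρ'.1 ∈ F.dem.filter (fun d => F.IsRainbow d) := hR ρ'.2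
  have hrf : ∀ D : Finset α, F.lab D = 1 → (D ∩ ρ'.1.1).Nonempty := hRF ρ'.1 ρ'.2
  have hρ' : ρ'.1 ∈ F.dem := (mem_filter.1 hρ'R).1
  have hr' : F.IsRainbow ρ'.1 := (mem_filter.1 hρ'R).2
  set supB := F.sup.filter (fun σ => F.lab σ.2 = 0) with hsupB
  -- the certificate functional of `ρ'` (supported on `sup_B`)
  let filtS := ((ρ'.1.1 ∪ ρ'.1.2)ᶜ).powerset.filter (fun S => F.lab S = 0 ∧ F.lab (ρ'.1.1ᶜ \ S) = 4)
  let kB : Finset α × Finset α → ZMod 2 := fun σ =>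
    ∑ S ∈ filtS, F.certN ρ'.1 S *
      (if σ.2 = S then
        ∑ R' ∈ (Sᶜ).powerset, (if F.lab R' = 0 ∧ (σ.1 ∪ σ.2)ᶜ ⊆ R' ∧ R' ⊆ Sᶜ \ ρ'.1.1 then (1 : ZMod 2) else 0)
       else 0)
  have hkB0 : ∀ σ ∈ F.sup, σ ∉ supB → kB σ = 0 := by
    intro σ hσ hσB
    refine sum_eq_zero fun S hS => ?_
    rw [if_neg, mul_zero]
    intro h
    exact hσB (mem_filter.2 ⟨hσ, by rw [h]; exact (mem_filter.1 hS).2.1⟩)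
  have hpt : ∀ σ : ↥supB, (∑ ρ, g ρ * F.rbVec ρ.1 σ.1) = 0 := by
    intro σ
    have := congrFun hg σ
    simpa [Finset.sum_apply, Pi.smul_apply, smul_eq_mul] using this
  have h0 : (∑ σ : ↥supB, kB σ.1 * (∑ ρ, g ρ * F.rbVec ρ.1 σ.1)) = 0 :=
    sum_eq_zero fun σ _ => by rw [hpt σ, mul_zero]
  rw [show (∑ σ : ↥supB, kB σ.1 * (∑ ρ, g ρ * F.rbVec ρ.1 σ.1))
      = ∑ ρ, g ρ * (∑ σ : ↥supB, kB σ.1 * F.rbVec ρ.1 σ.1) by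
    rw [show (∑ σ : ↥supB, kB σ.1 * (∑ ρ, g ρ * F.rbVec ρ.1 σ.1))
        = ∑ σ : ↥supB, ∑ ρ, g ρ * (kB σ.1 * F.rbVec ρ.1 σ.1) from
      sum_congr rfl fun σ _ => by rw [Finset.mul_sum]; exact sum_congr rfl fun ρ _ => by ring]
    rw [Finset.sum_comm]
    exact sum_congr rfl fun ρ _ => by rw [Finset.mul_sum]] at h0
  have hpair : ∀ ρ : ↥R,
      (∑ σ : ↥supB, kB σ.1 * F.rbVec ρ.1 σ.1) = if ρ = ρ' then 1 else 0 := by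
    intro ρ
    rw [Finset.sum_coe_sort supB (fun σ => kB σ * F.rbVec ρ.1 σ)]
    have hρR : ρ.1 ∈ F.dem.filter (fun d => F.IsRainbow d) := hR ρ.2
    have hfull := F.kB_rbVec_of_rivalFree (mem_filter.1 hρR).1 (mem_filter.1 hρR).2 hρ' hr' hrf
    -- the sum over `sup` equals the sum over `sup_B`
    have hrestr : (∑ σ ∈ F.sup, kB σ * F.rbVec ρ.1 σ) = ∑ σ ∈ supB, kB σ * F.rbVec ρ.1 σ := by
      rw [hsupB, Finset.sum_filter]
      refine sum_congr rfl fun σ hσ => ?_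
      by_cases h : F.lab σ.2 = 0
      · rw [if_pos h]
      · rw [if_neg h, hkB0 σ hσ (fun h' => h (mem_filter.1 h').2), zero_mul]
    simp only [kB] at hfull hrestr ⊢
    rw [← hrestr, hfull]
    by_cases h : ρ = ρ'
    · rw [if_pos h, if_pos (congrArg Subtype.val h)]
    · rw [if_neg h, if_neg fun h' => h (Subtype.ext h')]
  rw [sum_congr rfl fun ρ _ => by rw [hpair ρ]] at h0
  simp only [mul_ite, mul_one, mul_zero, Finset.sum_ite_eq', Finset.mem_univ, if_true] at h0
  exact h0

/-! ## The count -/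

/-- **RIVAL-FREE RAINBOWS ARE PAID BY THE BOTTOM SLACK** (this work): for every set `R` of rainbows whose first blocks are rival-free (every label-1 set
meets `Q1_ρ`), `#R ≤ Σ_{lab S = 0} cubeSlack Sᶜ`. [this work] -/
theorem card_rivalFree_le_bottomSlack (R : Finset (Finset α × Finset α))
    (hR : R ⊆ F.dem.filter (fun d => F.IsRainbow d)) (hRF : ∀ ρ ∈ R, ∀ D : Finset α, F.lab D = 1 → (D ∩ ρ.1).Nonempty) :
    (R.card : ℤ) ≤ ∑ S ∈ (Finset.univ : Finset (Finset α)).filter (fun S => F.lab S = 0), F.cubeSlack Sᶜ :=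
  F.card_le_slack_of_linearIndependent 0 (Or.inr rfl) R hR (F.tsB_linearIndependent_rivalFree R hR hRF)

end Sunflower

end Summit.CriticalPhenomena.PercolationContinuityZ3.Theorems.SunflowerPartition
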